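import Summits.CriticalPhenomena.PercolationContinuityZ3.Theorems.PercNearOneGluingNoHeavyQuantGluedShareDual
import Summits.CriticalPhenomena.PercolationContinuityZ3.Theorems.PercNearOneGluingNoHeavyQuantGluedCheapPool
import HarnessLib

/-!
# QUANT lane R8, T-DEC: LEMMA W's pair condition in the two-row regime, h LOW — REDUCTION TO AN ASSIGNMENT CERTIFICATE (four rows, three columns,
# NO cheap atom): what is left per cell is real algebra (arm-1 gen 60, architect)

builds on p205010 (kernel theorem, internal audit signed; external expert review pending)

Support file (`--supports stmt-CriticalPhenomena-4575`), QUANT lane seat prim-quant-arm-1 (gen 60, architect); memo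
`run/shared/lean/prim/quant/prim-quant-arm-1-g60/ARCH-G60.md` §1–§4.  Theorems only; standard axioms, no sorries, no definitions.  Companion of
`…QuantGluedWindowTwoRowShare` (h a mid).

THE REGIME.  Price system `(α, p)` of the positions at `(y, T, j)`, `y = ax`, `T = a(S + q(r+kg))`; window pair `(l, h)` (`l < h ≤ B`, `h ≤ j < h+r+k`,
`2l < aS < l+h`), `γ = pairGate y (aS) l h`; the TWO-ROW regime (`2(l+r) < T ≤ 2(l+r+k)`, `l+r+k ≤ j`) with `h` LOW (`2h < T`).  Rows: `l, l+r, h` and — when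
low — `h+r` (weights `(1−γ)t₀, (1−γ)t₁, γt₀, γt₁κ`, `κ = [h+r low]`); columns: `A = l+r+k` (capacity `(1−γ)t₂`, price `p(A)`), `G = h+r` when it is a mid
(capacity `γt₁(1−κ)(1−ι)`), and the POOL of giants `h+r+k` (+ `h+r` when `ι = [j < h+r] = 1`) at the plain giant rate `u = y/(1−y)` (capacity `γ(t₂+ιt₁)`,
least price) — no cheap atom is needed in this half (survey kit j297905: `nodisc_L2 = n`; exact census kit j301043/j301047: share-or-bottom-first holds in
every sampled configuration).  **`gluedPullback_windowPair_twoRow_low_of_assign`**: for inverse-rate bounds `ϖ ≥ 0` (`ϖ·usage ≤ 1`, or `ϖ = 0` when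
incompatible — from `GluedWindow.apow_heavy_valid` / `apow_light_valid` / `apow_giant_valid`) and shares `s ≥ 0` of column sums `≤ 1` satisfying the four
COVERAGE inequalities, `(1−γ)Ψ(l) + γΨ(h) ≤ 0`.  The cells `…_twoRow_farLight` / `…_nearLight` (arm-1 g59) are the instances "bottom copy to the pool, the
others shared"; the remaining heavy-row cells of memo ARCH-G59 §7 are instances with a genuinely fractional share (memo ARCH-G60 §3).

HONEST STATUS.  `GluedLemmaW` (flow form), `GluedDominatedMass`, the band, `SiblingStep`, `FarTreeRow` OPEN; RATE class (log\*) / honest sentence of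
`run/shared/lean/prim/quant/README.md` unchanged.  [this work].  Nothing here is cited as a published result.  The gluing rows served
[cite: KozmaNitzan2024, Conjecture 3 (p. 15)]; product measure [cite: Grimmett1999, §1.3 p. 10].
-/

set_option maxHeartbeats 4000000

noncomputable section

open scoped BigOperators

namespace Summit.CriticalPhenomena.PercolationContinuityZ3.Theorems
namespace Quant

open Finset

namespace LawDec

/-- **TWO-ROW REGIME, h LOW: THE PAIR CONDITION FROM AN ASSIGNMENT CERTIFICATE** (rows `l, l+r, h, h+r`; columns `A = l+r+k`, `G = h+r`, pool; see the
file header; rows are numbered `0,1,2,3`, `κ = [h+r low]`, `ι = [j < h+r]`). [this work] -/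
theorem gluedPullback_windowPair_twoRow_low_of_assign (x a q g S : ℝ) (B r k j l h : ℕ) (α p : ℕ → ℝ) (κ ι : ℝ)
    (ϖ0A ϖ1A ϖ2A ϖ3A ϖ0G ϖ1G ϖ2G s0A s1A s2A s3A s0G s1G s2G s0P s1P s2P s3P : ℝ)
    (hx0 : 0 < x) (hx1 : x < 1) (ha0 : 0 < a) (ha1 : a ≤ 1) (hq0 : 0 < q) (hq1 : q < 1) (hg0 : 0 ≤ g) (hg1 : g ≤ 1)
    (hlh : l < h) (hhB : h ≤ B) (hhj : h ≤ j) (hwin : j < h + r + k) (hlow : 2 * (l : ℝ) < a * S) (hcomp : a * S < (l : ℝ) + h)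
    (hL2j : l + r + k ≤ j) (hL2mid : a * (S + q * ((r : ℝ) + k * g)) ≤ 2 * ((l : ℝ) + r + k))
    (hL1low : 2 * ((l : ℝ) + r) < a * (S + q * ((r : ℝ) + k * g))) (hhlow : 2 * (h : ℝ) < a * (S + q * ((r : ℝ) + k * g)))
    (hHr : (2 * ((h : ℝ) + r) < a * (S + q * ((r : ℝ) + k * g)) ∧ h + r ≤ j ∧ κ = 1 ∧ ι = 0) ∨
      (a * (S + q * ((r : ℝ) + k * g)) ≤ 2 * ((h : ℝ) + r) ∧ h + r ≤ j ∧ κ = 0 ∧ ι = 0) ∨ (j < h + r ∧ κ = 0 ∧ ι = 1))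
    (hp : ∀ h, 0 ≤ p h)
    (hαp : ∀ l' h', l' ≤ j → 2 * (l' : ℝ) < a * (S + q * ((r : ℝ) + k * g)) → h' ≤ B + (r + k) →
      (j + 1 ≤ h' ∨ a * (S + q * ((r : ℝ) + k * g)) < (l' : ℝ) + h') →
      α l' ≤ usage (a * x) (a * (S + q * ((r : ℝ) + k * g))) j l' h' * p h')
    -- the certificate
    (hϖ0A : 0 ≤ ϖ0A) (hϖ1A : 0 ≤ ϖ1A) (hϖ2A : 0 ≤ ϖ2A) (hϖ3A : 0 ≤ ϖ3A) (hϖ0G : 0 ≤ ϖ0G) (hϖ1G : 0 ≤ ϖ1G) (hϖ2G : 0 ≤ ϖ2G)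
    (hs0A : 0 ≤ s0A) (hs1A : 0 ≤ s1A) (hs2A : 0 ≤ s2A) (hs3A : 0 ≤ s3A) (hs0G : 0 ≤ s0G) (hs1G : 0 ≤ s1G) (hs2G : 0 ≤ s2G)
    (hs0P : 0 ≤ s0P) (hs1P : 0 ≤ s1P) (hs2P : 0 ≤ s2P) (hs3P : 0 ≤ s3P)
    (hSA : s0A + s1A + s2A + s3A ≤ 1) (hSG : s0G + s1G + s2G ≤ 1) (hSP : s0P + s1P + s2P + s3P ≤ 1)
    (hv0A : ϖ0A * usage (a * x) (a * (S + q * ((r : ℝ) + k * g))) j l (l + r + k) ≤ 1)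
    (hc0A : ϖ0A = 0 ∨ a * (S + q * ((r : ℝ) + k * g)) < (l : ℝ) + ((l : ℝ) + r + k))
    (hv1A : ϖ1A * usage (a * x) (a * (S + q * ((r : ℝ) + k * g))) j (l + r) (l + r + k) ≤ 1)
    (hc1A : ϖ1A = 0 ∨ a * (S + q * ((r : ℝ) + k * g)) < ((l : ℝ) + r) + ((l : ℝ) + r + k))
    (hv2A : ϖ2A * usage (a * x) (a * (S + q * ((r : ℝ) + k * g))) j h (l + r + k) ≤ 1)
    (hc2A : ϖ2A = 0 ∨ a * (S + q * ((r : ℝ) + k * g)) < (h : ℝ) + ((l : ℝ) + r + k))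
    (hv3A : ϖ3A * usage (a * x) (a * (S + q * ((r : ℝ) + k * g))) j (h + r) (l + r + k) ≤ 1)
    (hc3A : ϖ3A = 0 ∨ a * (S + q * ((r : ℝ) + k * g)) < ((h : ℝ) + r) + ((l : ℝ) + r + k))
    (hv0G : ϖ0G * usage (a * x) (a * (S + q * ((r : ℝ) + k * g))) j l (h + r) ≤ 1)
    (hc0G : ϖ0G = 0 ∨ a * (S + q * ((r : ℝ) + k * g)) < (l : ℝ) + ((h : ℝ) + r))
    (hv1G : ϖ1G * usage (a * x) (a * (S + q * ((r : ℝ) + k * g))) j (l + r) (h + r) ≤ 1)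
    (hc1G : ϖ1G = 0 ∨ a * (S + q * ((r : ℝ) + k * g)) < ((l : ℝ) + r) + ((h : ℝ) + r))
    (hv2G : ϖ2G * usage (a * x) (a * (S + q * ((r : ℝ) + k * g))) j h (h + r) ≤ 1)
    (hc2G : ϖ2G = 0 ∨ a * (S + q * ((r : ℝ) + k * g)) < (h : ℝ) + ((h : ℝ) + r))
    -- coverage (pool at the plain giant rate: inverse rate (1 − y)/y)
    (hcov0 : (1 - pairGate (a * x) (a * S) l h) * (1 - q)
      ≤ s0A * ((1 - pairGate (a * x) (a * S) l h) * (q * g) * ϖ0A)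
        + s0G * (pairGate (a * x) (a * S) l h * (q * (1 - g)) * (1 - κ) * (1 - ι) * ϖ0G)
        + s0P * (pairGate (a * x) (a * S) l h * (q * g + ι * (q * (1 - g))) * ((1 - a * x) / (a * x))))
    (hcov1 : (1 - pairGate (a * x) (a * S) l h) * (q * (1 - g))
      ≤ s1A * ((1 - pairGate (a * x) (a * S) l h) * (q * g) * ϖ1A)
        + s1G * (pairGate (a * x) (a * S) l h * (q * (1 - g)) * (1 - κ) * (1 - ι) * ϖ1G)
        + s1P * (pairGate (a * x) (a * S) l h * (q * g + ι * (q * (1 - g))) * ((1 - a * x) / (a * x))))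
    (hcov2 : pairGate (a * x) (a * S) l h * (1 - q)
      ≤ s2A * ((1 - pairGate (a * x) (a * S) l h) * (q * g) * ϖ2A)
        + s2G * (pairGate (a * x) (a * S) l h * (q * (1 - g)) * (1 - κ) * (1 - ι) * ϖ2G)
        + s2P * (pairGate (a * x) (a * S) l h * (q * g + ι * (q * (1 - g))) * ((1 - a * x) / (a * x))))
    (hcov3 : pairGate (a * x) (a * S) l h * (q * (1 - g)) * κ
      ≤ s3A * ((1 - pairGate (a * x) (a * S) l h) * (q * g) * ϖ3A)
        + s3P * (pairGate (a * x) (a * S) l h * (q * g + ι * (q * (1 - g))) * ((1 - a * x) / (a * x)) * κ)) :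
    (1 - pairGate (a * x) (a * S) l h) * gluedPullback (a * (S + q * ((r : ℝ) + k * g))) q g j r k α p l
      + pairGate (a * x) (a * S) l h * gluedPullback (a * (S + q * ((r : ℝ) + k * g))) q g j r k α p h ≤ 0 := by
  set y : ℝ := a * x with hy
  set T : ℝ := a * (S + q * ((r : ℝ) + k * g)) with hT
  set T₀ : ℝ := a * S with hT₀
  set γ : ℝ := pairGate (a * x) (a * S) l h with hγ
  set t0 : ℝ := 1 - q with ht0
  set t1 : ℝ := q * (1 - g) with ht1
  set t2 : ℝ := q * g with ht2
  have hy0 : 0 < y := by rw [hy]; exact mul_pos ha0 hx0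
  have hyx : y ≤ x := by rw [hy]; nlinarith
  have hy1 : y < 1 := by linarith
  have h1y : 0 < 1 - y := by linarith
  have hu0 : 0 ≤ y / (1 - y) := div_nonneg hy0.le h1y.le
  have hiu0 : 0 ≤ (1 - y) / y := div_nonneg h1y.le hy0.le
  have ht0p : 0 ≤ t0 := by rw [ht0]; linarith
  have ht1p : 0 ≤ t1 := by rw [ht1]; exact mul_nonneg hq0.le (by linarith)
  have ht2p : 0 ≤ t2 := by rw [ht2]; exact mul_nonneg hq0.le hg0
  have hγ0 : 0 < γ := by rw [hγ]; exact pairGate_pos (a * x) (a * S) l h hlow hlh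
  have hγ1 : γ < 1 := by rw [hγ]; exact pairGate_lt_one (a * x) (a * S) l h hy0 hy1 hlow hcomp
  have h1γ : 0 ≤ 1 - γ := by linarith
  have hκι : (0 ≤ κ ∧ κ ≤ 1) ∧ (0 ≤ ι ∧ ι ≤ 1) := by
    rcases hHr with ⟨_, _, e1, e2⟩ | ⟨_, _, e1, e2⟩ | ⟨_, e1, e2⟩ <;> rw [e1, e2] <;> norm_num
  -- statuses
  have hL0 : l ≤ j ∧ 2 * (l : ℝ) < T := ⟨by omega, by linarith⟩
  have hL1 : l + r ≤ j ∧ 2 * ((l + r : ℕ) : ℝ) < T := ⟨by omega, by push_cast; linarith⟩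
  have hH0 : h ≤ j ∧ 2 * (h : ℝ) < T := ⟨hhj, hhlow⟩
  have hL2n : ¬ (l + r + k ≤ j ∧ 2 * ((l + r + k : ℕ) : ℝ) < T) := by push_cast; intro hh; linarith [hh.2]
  have hH2n : ¬ (h + r + k ≤ j ∧ 2 * ((h + r + k : ℕ) : ℝ) < T) := fun hh => absurd hh.1 (by omega)
  have cL : ∀ v : ℕ, (v ≤ j ∧ 2 * (v : ℝ) < T) → coefAt T j α p v = α v := fun v hv => by simp only [coefAt, if_pos hv]
  have cN : ∀ v : ℕ, ¬ (v ≤ j ∧ 2 * (v : ℝ) < T) → coefAt T j α p v = -p v := fun v hv => by simp only [coefAt, if_neg hv]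
  have eΨl : gluedPullback T q g j r k α p l = t0 * α l + t1 * α (l + r) - t2 * p (l + r + k) := by
    simp only [gluedPullback, cL l hL0, cL (l + r) hL1, cN (l + r + k) hL2n, ht0, ht1, ht2]; ring
  have eΨh : gluedPullback T q g j r k α p h = t0 * α h + t1 * coefAt T j α p (h + r) - t2 * p (h + r + k) := by
    simp only [gluedPullback, cL h hH0, cN (h + r + k) hH2n, ht0, ht1, ht2]; ring
  -- the pool price: least price among the giants h+r+k (and h+r when it is a giant)
  obtain ⟨q1, hq1d⟩ : ∃ q1 : ℝ, q1 = if h + r ≤ j then p (h + r + k) else p (h + r) := ⟨_, rfl⟩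
  obtain ⟨P, hP⟩ : ∃ P : ℝ, P = min (p (h + r + k)) q1 := ⟨_, rfl⟩
  have hPH2 : P ≤ p (h + r + k) := by rw [hP]; exact min_le_left _ _
  have hPq1 : P ≤ q1 := by rw [hP]; exact min_le_right _ _
  have hP0 : 0 ≤ P := by
    rw [hP]; refine le_min (hp _) ?_
    rw [hq1d]; split_ifs <;> exact hp _
  have giantChoice : ∃ G : ℕ, j + 1 ≤ G ∧ G ≤ B + (r + k) ∧ P = p G := by
    rw [hP]
    rcases min_choice (p (h + r + k)) q1 with e | e <;> rw [e]
    · exact ⟨h + r + k, by omega, by omega, rfl⟩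
    · rw [hq1d]; split_ifs with hh
      · exact ⟨h + r + k, by omega, by omega, rfl⟩
      · exact ⟨h + r, by omega, by omega, rfl⟩
  obtain ⟨G, hGj, hGM, hPG⟩ := giantChoice
  have giantP : ∀ w : ℕ, (w ≤ j ∧ 2 * (w : ℝ) < T) → α w ≤ y / (1 - y) * P := by
    intro w hw
    have := hαp w G hw.1 hw.2 hGM (Or.inl hGj)
    rwa [usage_giant_eq y T j w G hGj, ← hPG] at this
  -- prices and capacities of the three columns
  set pA : ℝ := p (l + r + k) with hpA
  set pG : ℝ := p (h + r) with hpG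
  have hpA0 : 0 ≤ pA := hp _
  have hpG0 : 0 ≤ pG := hp _
  obtain ⟨cA, hcA⟩ : ∃ cA : ℝ, cA = (1 - γ) * t2 := ⟨_, rfl⟩
  obtain ⟨cG, hcG⟩ : ∃ cG : ℝ, cG = γ * t1 * (1 - κ) * (1 - ι) := ⟨_, rfl⟩
  obtain ⟨cP, hcP⟩ : ∃ cP : ℝ, cP = γ * (t2 + ι * t1) := ⟨_, rfl⟩
  have hcA0 : 0 ≤ cA := by rw [hcA]; exact mul_nonneg h1γ ht2p
  have hcG0 : 0 ≤ cG := by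
    rw [hcG]; exact mul_nonneg (mul_nonneg (mul_nonneg hγ0.le ht1p) (by linarith [hκι.1.2])) (by linarith [hκι.2.2])
  have hcP0 : 0 ≤ cP := by rw [hcP]; exact mul_nonneg hγ0.le (by nlinarith [hκι.2.1, ht1p, ht2p])
  have eL1 : ((l + r : ℕ) : ℝ) = (l : ℝ) + r := by push_cast; ring
  have eL2 : ((l + r + k : ℕ) : ℝ) = (l : ℝ) + r + k := by push_cast; ring
  have eH1 : ((h + r : ℕ) : ℝ) = (h : ℝ) + r := by push_cast; ring
  have hL2M : l + r + k ≤ B + (r + k) := by omega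
  have hH1M : h + r ≤ B + (r + k) := by omega
  -- validity facts
  have vA : ∀ (v : ℕ) (ϖ : ℝ), 0 ≤ ϖ → ϖ * usage y T j v (l + r + k) ≤ 1 →
      (ϖ = 0 ∨ ((v ≤ j ∧ 2 * (v : ℝ) < T) ∧ T < (v : ℝ) + ((l : ℝ) + r + k))) → cA * ϖ * α v ≤ cA * pA := by
    intro v ϖ hϖ hval hc
    rcases hc with e | ⟨hv, hc⟩
    · rw [e, mul_zero, zero_mul]; exact mul_nonneg hcA0 hpA0
    · have hb : α v ≤ usage y T j v (l + r + k) * pA := hαp v (l + r + k) hv.1 hv.2 hL2M (Or.inr (by rw [eL2]; exact hc))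
      exact GluedWindow.apow_of_usage (cA * ϖ) (usage y T j v (l + r + k)) cA (α v) pA (mul_nonneg hcA0 hϖ) hpA0 hb
        (by rw [mul_assoc]; exact le_trans (mul_le_mul_of_nonneg_left hval hcA0) (by rw [mul_one]))
  have vG : ∀ (v : ℕ) (ϖ : ℝ), 0 ≤ ϖ → (v ≤ j ∧ 2 * (v : ℝ) < T) → ϖ * usage y T j v (h + r) ≤ 1 →
      (ϖ = 0 ∨ T < (v : ℝ) + ((h : ℝ) + r)) → cG * ϖ * α v ≤ cG * pG := by
    intro v ϖ hϖ hv hval hc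
    rcases hc with e | hc
    · rw [e, mul_zero, zero_mul]; exact mul_nonneg hcG0 hpG0
    · have hb : α v ≤ usage y T j v (h + r) * pG := hαp v (h + r) hv.1 hv.2 hH1M (Or.inr (by rw [eH1]; exact hc))
      exact GluedWindow.apow_of_usage (cG * ϖ) (usage y T j v (h + r)) cG (α v) pG (mul_nonneg hcG0 hϖ) hpG0 hb
        (by rw [mul_assoc]; exact le_trans (mul_le_mul_of_nonneg_left hval hcG0) (by rw [mul_one]))
  have vP : ∀ (v : ℕ), (v ≤ j ∧ 2 * (v : ℝ) < T) → cP * ((1 - y) / y) * α v ≤ cP * P := by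
    intro v hv
    refine GluedWindow.apow_of_usage (cP * ((1 - y) / y)) (y / (1 - y)) cP (α v) P (mul_nonneg hcP0 hiu0) hP0 (giantP v hv) ?_
    have e : cP * ((1 - y) / y) * (y / (1 - y)) = cP := by
      rw [mul_assoc, div_mul_div_comm, mul_comm (1 - y) y, div_self (mul_ne_zero hy0.ne' h1y.ne'), mul_one]
    rw [e]
  -- row h + r: low (κ = 1) or absent (κ = 0)
  have row3 : (κ = 1 ∧ (h + r ≤ j ∧ 2 * ((h + r : ℕ) : ℝ) < T)) ∨ κ = 0 := by
    rcases hHr with ⟨h1, h2, e1, _⟩ | ⟨_, _, e1, _⟩ | ⟨_, e1, _⟩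
    · exact Or.inl ⟨e1, h2, by rw [eH1]; exact h1⟩
    · exact Or.inr e1
    · exact Or.inr e1
  have v3A : cA * ϖ3A * α (h + r) ≤ cA * pA ∨ κ = 0 := by
    rcases row3 with ⟨_, hv⟩ | e
    · refine Or.inl (vA (h + r) ϖ3A hϖ3A hv3A ?_)
      rcases hc3A with e | hc
      · exact Or.inl e
      · exact Or.inr ⟨hv, by rw [eH1]; exact hc⟩
    · exact Or.inr e
  have v3P : cP * ((1 - y) / y) * κ * α (h + r) ≤ cP * κ * P := by
    rcases row3 with ⟨e, hv⟩ | e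
    · rw [e, mul_one, mul_one]; exact vP (h + r) hv
    · rw [e]; simp only [mul_zero, zero_mul, le_refl]
  -- assemble with the 4 × 3 assignment lemma; row 3 (h + r) has weight γ t1 κ, uses A with power cA ϖ3A κ-guarded via the case split below
  have hw3 : 0 ≤ γ * t1 * κ := mul_nonneg (mul_nonneg hγ0.le ht1p) hκι.1.1
  have key : (1 - γ) * t0 * α l + (1 - γ) * t1 * α (l + r) + γ * t0 * α h + γ * t1 * κ * α (h + r) ≤ cA * pA + cG * pG + cP * P := by
    rcases v3A with v3A | e
    · exact GluedWindow.assign_dual_four_three (α l) (α (l + r)) (α h) (α (h + r))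
        ((1 - γ) * t0) ((1 - γ) * t1) (γ * t0) (γ * t1 * κ) cA cG cP pA pG P
        (cA * ϖ0A) (cG * ϖ0G) (cP * ((1 - y) / y)) (cA * ϖ1A) (cG * ϖ1G) (cP * ((1 - y) / y))
        (cA * ϖ2A) (cG * ϖ2G) (cP * ((1 - y) / y)) (cA * ϖ3A) 0 (cP * ((1 - y) / y) * κ)
        s0A s0G s0P s1A s1G s1P s2A s2G s2P s3A 0 s3P
        hcA0 hcG0 hcP0 hpA0 hpG0 hP0 hs0A hs0G hs0P hs1A hs1G hs1P hs2A hs2G hs2P hs3A le_rfl hs3P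
        (by linarith) (by linarith) (by linarith)
        (vA l ϖ0A hϖ0A hv0A (by rcases hc0A with e | hc; exacts [Or.inl e, Or.inr ⟨hL0, hc⟩])) (vG l ϖ0G hϖ0G hL0 hv0G hc0G) (vP l hL0)
        (vA (l + r) ϖ1A hϖ1A hv1A (by rcases hc1A with e | hc; exacts [Or.inl e, Or.inr ⟨hL1, by rw [eL1]; exact hc⟩]))
        (vG (l + r) ϖ1G hϖ1G hL1 hv1G (by rw [eL1]; exact hc1G)) (vP (l + r) hL1)
        (vA h ϖ2A hϖ2A hv2A (by rcases hc2A with e | hc; exacts [Or.inl e, Or.inr ⟨hH0, hc⟩])) (vG h ϖ2G hϖ2G hH0 hv2G hc2G) (vP h hH0)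
        v3A (by rw [zero_mul]; exact mul_nonneg hcG0 hpG0) (by
          have h1 := mul_le_mul_of_nonneg_left hκι.1.2 (mul_nonneg hcP0 hP0)
          calc cP * ((1 - y) / y) * κ * α (h + r) ≤ cP * κ * P := v3P
            _ = cP * P * κ := by ring
            _ ≤ cP * P * 1 := h1
            _ = cP * P := by ring)
        (mul_nonneg h1γ ht0p) (mul_nonneg h1γ ht1p) (mul_nonneg hγ0.le ht0p) hw3
        (by rw [hcA, hcG, hcP]; linarith [hcov0]) (by rw [hcA, hcG, hcP]; linarith [hcov1])
        (by rw [hcA, hcG, hcP]; linarith [hcov2])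
        (by rw [hcA, hcP]; linarith [hcov3])
    · -- κ = 0: the row h + r is absent; run the three-row version (row 3 with weight 0)
      have k3 := GluedWindow.assign_dual_four_three (α l) (α (l + r)) (α h) 0
        ((1 - γ) * t0) ((1 - γ) * t1) (γ * t0) 0 cA cG cP pA pG P
        (cA * ϖ0A) (cG * ϖ0G) (cP * ((1 - y) / y)) (cA * ϖ1A) (cG * ϖ1G) (cP * ((1 - y) / y))
        (cA * ϖ2A) (cG * ϖ2G) (cP * ((1 - y) / y)) 0 0 0
        s0A s0G s0P s1A s1G s1P s2A s2G s2P 0 0 0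
        hcA0 hcG0 hcP0 hpA0 hpG0 hP0 hs0A hs0G hs0P hs1A hs1G hs1P hs2A hs2G hs2P le_rfl le_rfl le_rfl
        (by linarith) (by linarith) (by linarith)
        (vA l ϖ0A hϖ0A hv0A (by rcases hc0A with e | hc; exacts [Or.inl e, Or.inr ⟨hL0, hc⟩])) (vG l ϖ0G hϖ0G hL0 hv0G hc0G) (vP l hL0)
        (vA (l + r) ϖ1A hϖ1A hv1A (by rcases hc1A with e | hc; exacts [Or.inl e, Or.inr ⟨hL1, by rw [eL1]; exact hc⟩]))
        (vG (l + r) ϖ1G hϖ1G hL1 hv1G (by rw [eL1]; exact hc1G)) (vP (l + r) hL1)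
        (vA h ϖ2A hϖ2A hv2A (by rcases hc2A with e | hc; exacts [Or.inl e, Or.inr ⟨hH0, hc⟩])) (vG h ϖ2G hϖ2G hH0 hv2G hc2G) (vP h hH0)
        (by rw [zero_mul]; exact mul_nonneg hcA0 hpA0) (by rw [zero_mul]; exact mul_nonneg hcG0 hpG0)
        (by rw [zero_mul]; exact mul_nonneg hcP0 hP0)
        (mul_nonneg h1γ ht0p) (mul_nonneg h1γ ht1p) (mul_nonneg hγ0.le ht0p) le_rfl
        (by rw [hcA, hcG, hcP]; linarith [hcov0]) (by rw [hcA, hcG, hcP]; linarith [hcov1])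
        (by rw [hcA, hcG, hcP]; linarith [hcov2]) (by norm_num)
      rw [e]
      linarith [k3]
  rw [hcA, hcG, hcP] at key
  have a1 : γ * t2 * P ≤ γ * t2 * p (h + r + k) := mul_le_mul_of_nonneg_left hPH2 (mul_nonneg hγ0.le ht2p)
  rw [eΨl, eΨh]
  rcases hHr with ⟨h1, h2, e1, e2⟩ | ⟨h1, h2, e1, e2⟩ | ⟨h1, e1, e2⟩
  · -- h + r low: a row
    rw [cL (h + r) ⟨h2, by rw [eH1]; exact h1⟩]
    rw [e1, e2] at key
    linarith [key, a1]
  · -- h + r a mid ≤ j: a priced column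
    rw [cN (h + r) (fun hh => by rw [eH1] at hh; linarith [hh.2])]
    rw [e1, e2] at key
    have : -p (h + r) = -pG := by rw [hpG]
    linarith [key, a1, mul_nonneg (mul_nonneg hγ0.le ht1p) hpG0]
  · -- h + r a giant: in the pool
    rw [cN (h + r) (fun hh => absurd hh.1 (by omega))]
    rw [e1, e2] at key
    have hq1' : q1 = p (h + r) := by rw [hq1d, if_neg (by omega)]
    have a2 : γ * t1 * P ≤ γ * t1 * pG := mul_le_mul_of_nonneg_left (by rw [hpG, ← hq1']; exact hPq1) (mul_nonneg hγ0.le ht1p)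
    linarith [key, a1, a2]

end LawDec
end Quant
end Summit.CriticalPhenomena.PercolationContinuityZ3.Theorems
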